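import Mathlib
import HarnessLib
import Summits.Ventures.LatticeQCDFlow.Scoring.GreenKuboDegenerate

/-!
# The degenerate case `σ²_f = 0` in numbers: `E_{μ₀}[S_{s,n}²] ≤ 8 C_h² + 4 C_h² A ρ^s/(1−ρ)` from ANY
# start and every block length, and `E_π[S_{s,n}²] = 2 (∫ h² dπ − ∫ h (kop κ)^[n] h dπ) → 2 Var_π(h)`

HONEST FRAMING: exact (Metropolis-corrected) sampling algorithms for lattice gauge theory;
figures of merit are autocorrelation/cost numbers at stated couplings and volumes; no
continuum-physics claim.

Venture `LatticeQCDFlow` (cell pub-lqcd), topic `Scoring`; FANOUT row 8 (`s0-cpn-nemc`, GEN-23).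
NEW WORK of the cell, not a published result; no definition is introduced; nothing is cited as a
fact.  `Scoring/GreenKuboDegenerate` characterised `σ²_f = 0` (envelope
`|(kop κ)^[t] g − πg| ≤ 2 C_g A ρ^t`, `0 ≤ ρ < 1`, `π` invariant, `|f| ≤ C` measurable, `h` a bounded
measurable Poisson solution `h − kop κ h = f̄ = f − πf`, `|h| ≤ C_h`) as the COBOUNDARY case: every
centred block sum `S_{s,n} = Σ_{t<n} f̄(X_{s+t})` equals `h(X_s) − h(X_{s+n})` `P_π`-a.s., and from any
start the block martingale has `E_{μ₀}[M_{s,n}²] ≤ 2 C_h² A ρ^s/(1−ρ)`.  THIS FILE reads off the second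
moments.  (i) From ANY initial law, by `S = M + h(X_s) − h(X_{s+n})` pointwise:
`E_{μ₀}[S_{s,n}²] ≤ 2 E M² + 2 (2C_h)² ≤ 8 C_h² + 4 C_h² A ρ^s/(1−ρ)` for every block length `n`.
(ii) Under `P_π`: `E_π[(h(X_s) − h(X_{s+n}))²] = 2 ∫ h² dπ − 2 ∫ h (kop κ)^[n] h dπ` (one-time marginals
`π`, two-time moment through `(kop κ)^[n]`), the envelope gives
`|∫ h (kop κ)^[n] h dπ − (∫ h dπ)²| ≤ 2 C_h² A ρ^n`, so `E_π[S_{s,n}²] = 2 (∫ h² dπ − ∫ h (kop κ)^[n] h dπ)`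
for EVERY `s, n` and `E_π[S_{s,n}²] → 2 Var_π(h)` as `n → ∞`: in the degenerate case the stationary
second moment of a centred block sum converges to twice the variance of the Poisson solution instead
of growing.  The identification of the leading-bias constant `Γ_f = −Var_π(h)` that follows is the
companion file `Scoring/GreenKuboDegenerateLeadingBias`.  Printed counterpart NAMED ONLY: the
null-variance case for `V`-uniformly ergodic chains (Meyn–Tweedie, *Markov Chains and Stochastic
Stability*, Thm 17.5.4) — nothing is cited as a fact.

## Content (envelope `(A, ρ)`, `0 ≤ ρ < 1`, `π` invariant; `|f| ≤ C` measurable; `h − kop κ h = f − πf`,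
## `|h| ≤ C_h` measurable; `σ²_f = ∫ f̄² dπ + 2 Σ' k, ∫ f̄ (kop κ)^[k+1] f̄ dπ`)

* **`chain_blockSum_sq_le_of_greenKubo_eq_zero`** — `σ²_f = 0 ⇒ E_{μ₀}[S_{s,n}²] ≤ 8 C_h² + 4 C_h² A ρ^s/(1−ρ)`
  for every `μ₀`, `s`, `n`;
* `chain_sq_sub_eq_of_stationary` — `E_π[(h(X_s) − h(X_{s+n}))²] = 2 ∫ h² dπ − 2 ∫ h (kop κ)^[n] h dπ`;
* `abs_integral_mul_iterate_kop_sub_sq_le_of_envelope` — `|∫ h (kop κ)^[n] h dπ − (∫ h dπ)²| ≤ 2 C_h² A ρ^n`;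
  `tendsto_integral_mul_iterate_kop_of_envelope` — `∫ h (kop κ)^[n] h dπ → (∫ h dπ)²`;
* **`chain_blockSum_sq_eq_of_greenKubo_eq_zero`** — `σ²_f = 0 ⇒ E_π[S_{s,n}²] = 2 (∫ h² dπ − ∫ h (kop κ)^[n] h dπ)`;
* **`tendsto_chain_blockSum_sq_of_greenKubo_eq_zero`** — `σ²_f = 0 ⇒ E_π[S_{s,n}²] → 2 (∫ h² dπ − (∫ h dπ)²)`.

NOT CLAIMED: the value of `Γ_f` (companion file); reversible kernels; unbounded observables; any
`A, ρ` of a concrete sampler; any number of ours.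
-/

noncomputable section

namespace Summit.Ventures.LatticeQCDFlow.Scoring

open MeasureTheory ProbabilityTheory Filter Finset Preorder Literature.Probability.MarkovChains
open scoped ENNReal Topology

variable {Ω : Type*} [MeasurableSpace Ω]

section Envelope

variable {κ : Kernel Ω Ω} [IsMarkovKernel κ] {π : Measure Ω} [IsProbabilityMeasure π] {A ρ : ℝ}

/-! ### From any start: a uniform second-moment bound with the Poisson solution's constants -/

/-- **`σ²_f = 0 ⇒ E_{μ₀}[S_{s,n}²] ≤ 8 C_h² + 4 C_h² A ρ^s/(1−ρ)`** for every initial law `μ₀`, every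
block position `s` and EVERY block length `n` (`S_{s,n} = Σ_{t<n} (f(X_{s+t}) − πf)`, `h` any bounded
measurable Poisson solution, `|h| ≤ C_h`): in the degenerate case the centred block sums have UNIFORMLY
BOUNDED second moments. -/
theorem chain_blockSum_sq_le_of_greenKubo_eq_zero (hπ : Kernel.Invariant κ π)
    (henv : ∀ (g : Ω → ℝ), Measurable g → ∀ (Cg : ℝ), (∀ x, |g x| ≤ Cg) →
      ∀ (t : ℕ) (x : Ω), |(kop κ)^[t] g x - ∫ y, g y ∂π| ≤ 2 * Cg * (A * ρ ^ t))
    (hρ0 : 0 ≤ ρ) (hρ1 : ρ < 1)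
    {f : Ω → ℝ} (hf : Measurable f) {C : ℝ} (hC : ∀ x, |f x| ≤ C)
    {h : Ω → ℝ} (hh : Measurable h) {Ch : ℝ} (hCh : ∀ x, |h x| ≤ Ch)
    (hpois : ∀ y, h y - kop κ h y = f y - ∫ z, f z ∂π)
    (hσ : (∫ y, (f y - ∫ z, f z ∂π) ^ 2 ∂π)
        + 2 * ∑' k, ∫ y, (f y - ∫ z, f z ∂π) * (kop κ)^[k + 1] (fun y => f y - ∫ z, f z ∂π) y ∂π
        = 0)
    (μ₀ : Measure Ω) [IsProbabilityMeasure μ₀] (s n : ℕ) :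
    ∫ x, (∑ t ∈ Finset.range n, (f (x (s + t)) - ∫ z, f z ∂π)) ^ 2
        ∂(Kernel.trajMeasure (X := fun _ : ℕ => Ω) μ₀
          (fun n : ℕ => κ.comap (fun h : (i : ↥(Finset.Iic n)) → Ω => h ⟨n, Finset.mem_Iic.2 le_rfl⟩)
            (measurable_pi_apply _)))
      ≤ 8 * Ch ^ 2 + 4 * Ch ^ 2 * A * ρ ^ s / (1 - ρ) := by
  set P := Kernel.trajMeasure (X := fun _ : ℕ => Ω) μ₀
      (fun n : ℕ => κ.comap (fun h : (i : ↥(Finset.Iic n)) → Ω => h ⟨n, Finset.mem_Iic.2 le_rfl⟩)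
        (measurable_pi_apply _)) with hP
  obtain ⟨hfb, hCfb, -⟩ := centred_observable_bounds π hf hC
  set M : (ℕ → Ω) → ℝ := fun x =>
    ∑ t ∈ Finset.range n, (h (x (s + t + 1)) - kop κ h (x (s + t))) with hMdef
  have hMm : Measurable M := blockMartingale_measurable κ hh s n
  have hMb : ∀ x, |M x| ≤ n * (2 * Ch) := abs_blockMartingale_le κ hCh s n
  have hM2 : ∫ x, M x ^ 2 ∂P ≤ 2 * Ch ^ 2 * A * ρ ^ s / (1 - ρ) :=
    chain_blockMartingale_sq_le_of_greenKubo_eq_zero hπ henv hρ0 hρ1 hf hC hh hCh hpois hσ μ₀ s n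
  have hΔb : ∀ x : ℕ → Ω, |h (x s) - h (x (s + n))| ≤ 2 * Ch := fun x =>
    (abs_sub _ _).trans (by linarith [hCh (x s), hCh (x (s + n))])
  have hpt : ∀ x : ℕ → Ω, (∑ t ∈ Finset.range n, (f (x (s + t)) - ∫ z, f z ∂π)) ^ 2
      ≤ 2 * M x ^ 2 + 2 * (2 * Ch) ^ 2 := fun x => by
    rw [blockSum_eq_blockMartingale_add (kop κ) hpois s n x]
    have h2 : (h (x s) - h (x (s + n))) ^ 2 ≤ (2 * Ch) ^ 2 :=
      (sq_abs _).symm.trans_le (pow_le_pow_left₀ (abs_nonneg _) (hΔb x) 2)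
    nlinarith [sq_nonneg (M x - (h (x s) - h (x (s + n))))]
  have hiL : Integrable (fun x : ℕ → Ω =>
      (∑ t ∈ Finset.range n, (f (x (s + t)) - ∫ z, f z ∂π)) ^ 2) P := by
    have hSm : Measurable fun x : ℕ → Ω => ∑ t ∈ Finset.range n, (f (x (s + t)) - ∫ z, f z ∂π) :=
      Finset.measurable_sum _ fun t _ => hfb.comp (measurable_pi_apply _)
    refine integrable_of_bounded P (hSm.pow_const 2) (C := (n * (2 * Ch) + 2 * Ch) ^ 2) fun x => ?_
    rw [abs_pow]
    refine pow_le_pow_left₀ (abs_nonneg _) ?_ 2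
    rw [blockSum_eq_blockMartingale_add (kop κ) hpois s n x, add_sub_assoc]
    exact (abs_add_le _ _).trans (add_le_add (hMb x) (hΔb x))
  have hiR : Integrable (fun x => 2 * M x ^ 2 + 2 * (2 * Ch) ^ 2) P :=
    (((integrable_of_bounded P (hMm.pow_const 2) (C := (n * (2 * Ch)) ^ 2) fun x => by
      rw [abs_pow]; exact pow_le_pow_left₀ (abs_nonneg _) (hMb x) 2)).const_mul 2).add
      (integrable_const _)
  have hiM2 : Integrable (fun x => M x ^ 2) P :=
    integrable_of_bounded P (hMm.pow_const 2) (C := (n * (2 * Ch)) ^ 2) fun x => by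
      rw [abs_pow]; exact pow_le_pow_left₀ (abs_nonneg _) (hMb x) 2
  calc ∫ x, (∑ t ∈ Finset.range n, (f (x (s + t)) - ∫ z, f z ∂π)) ^ 2 ∂P
      ≤ ∫ x, (2 * M x ^ 2 + 2 * (2 * Ch) ^ 2) ∂P := integral_mono hiL hiR hpt
    _ = 2 * ∫ x, M x ^ 2 ∂P + 2 * (2 * Ch) ^ 2 := by
        rw [integral_add (hiM2.const_mul 2) (integrable_const _), integral_const_mul, integral_const,
          probReal_univ, one_smul]
    _ ≤ 2 * (2 * Ch ^ 2 * A * ρ ^ s / (1 - ρ)) + 2 * (2 * Ch) ^ 2 := by linarith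
    _ = 8 * Ch ^ 2 + 4 * Ch ^ 2 * A * ρ ^ s / (1 - ρ) := by ring

/-! ### Under `P_π`: the second moment of the boundary term and its limit -/

/-- `E_π[(h(X_s) − h(X_{s+n}))²] = 2 ∫ h² dπ − 2 ∫ h · (kop κ)^[n] h dπ` for the stationary chain and
bounded measurable `h`. -/
theorem chain_sq_sub_eq_of_stationary (hπ : Kernel.Invariant κ π)
    {h : Ω → ℝ} (hh : Measurable h) {Ch : ℝ} (hCh : ∀ x, |h x| ≤ Ch) (s n : ℕ) :
    ∫ x, (h (x s) - h (x (s + n))) ^ 2 ∂(Kernel.trajMeasure (X := fun _ : ℕ => Ω) π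
        (fun n : ℕ => κ.comap (fun h : (i : ↥(Finset.Iic n)) → Ω => h ⟨n, Finset.mem_Iic.2 le_rfl⟩)
          (measurable_pi_apply _)))
      = 2 * ∫ y, h y ^ 2 ∂π - 2 * ∫ y, h y * (kop κ)^[n] h y ∂π := by
  set P := Kernel.trajMeasure (X := fun _ : ℕ => Ω) π
      (fun n : ℕ => κ.comap (fun h : (i : ↥(Finset.Iic n)) → Ω => h ⟨n, Finset.mem_Iic.2 le_rfl⟩)
        (measurable_pi_apply _)) with hP
  have hCh0 : 0 ≤ Ch := (abs_nonneg _).trans (hCh (Classical.choice (nonempty_of_isProbabilityMeasure π)))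
  have hh2 : Measurable fun y => h y ^ 2 := hh.pow_const 2
  have hCh2 : ∀ y, |h y ^ 2| ≤ Ch ^ 2 := fun y => by
    rw [abs_pow]; exact pow_le_pow_left₀ (abs_nonneg _) (hCh y) 2
  have e1 : ∫ x, h (x s) ^ 2 ∂P = ∫ y, h y ^ 2 ∂π := chain_marginal hπ s hh2 hCh2
  have e2 : ∫ x, h (x (s + n)) ^ 2 ∂P = ∫ y, h y ^ 2 ∂π := chain_marginal hπ (s + n) hh2 hCh2
  have e3 : ∫ x, h (x s) * h (x (s + n)) ∂P = ∫ y, h y * (kop κ)^[n] h y ∂π :=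
    chain_twoTime_eq_integral hπ hh hCh hh hCh s n
  have hi1 : Integrable (fun x : ℕ → Ω => h (x s) ^ 2) P :=
    integrable_of_bounded P ((hh.comp (measurable_pi_apply _)).pow_const 2) fun x => hCh2 _
  have hi2 : Integrable (fun x : ℕ → Ω => h (x (s + n)) ^ 2) P :=
    integrable_of_bounded P ((hh.comp (measurable_pi_apply _)).pow_const 2) fun x => hCh2 _
  have hi3 : Integrable (fun x : ℕ → Ω => h (x s) * h (x (s + n))) P :=
    integrable_of_bounded P ((hh.comp (measurable_pi_apply _)).mul (hh.comp (measurable_pi_apply _)))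
      (C := Ch * Ch) fun x => by
      rw [abs_mul]; exact mul_le_mul (hCh _) (hCh _) (abs_nonneg _) hCh0
  have hexp : (fun x : ℕ → Ω => (h (x s) - h (x (s + n))) ^ 2)
      = fun x => (h (x s) ^ 2 + h (x (s + n)) ^ 2) - 2 * (h (x s) * h (x (s + n))) := by
    funext x; ring
  have hi12 : Integrable (fun x : ℕ → Ω => h (x s) ^ 2 + h (x (s + n)) ^ 2) P := hi1.add hi2
  have hi3' : Integrable (fun x : ℕ → Ω => 2 * (h (x s) * h (x (s + n)))) P := hi3.const_mul 2
  rw [hexp, integral_sub hi12 hi3', integral_add hi1 hi2, integral_const_mul, e1, e2, e3]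
  ring

omit [IsMarkovKernel κ] in
/-- `|∫ h · (kop κ)^[n] h dπ − (∫ h dπ)²| ≤ 2 C_h² A ρ^n` under the envelope: the two-time moment
decorrelates geometrically. -/
theorem abs_integral_mul_iterate_kop_sub_sq_le_of_envelope
    (henv : ∀ (g : Ω → ℝ), Measurable g → ∀ (Cg : ℝ), (∀ x, |g x| ≤ Cg) →
      ∀ (t : ℕ) (x : Ω), |(kop κ)^[t] g x - ∫ y, g y ∂π| ≤ 2 * Cg * (A * ρ ^ t))
    {h : Ω → ℝ} (hh : Measurable h) {Ch : ℝ} (hCh : ∀ x, |h x| ≤ Ch) (n : ℕ) :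
    |∫ y, h y * (kop κ)^[n] h y ∂π - (∫ y, h y ∂π) ^ 2| ≤ 2 * Ch ^ 2 * A * ρ ^ n := by
  have hCh0 : 0 ≤ Ch := (abs_nonneg _).trans (hCh (Classical.choice (nonempty_of_isProbabilityMeasure π)))
  set m := ∫ y, h y ∂π with hm
  have hKm : Measurable ((kop κ)^[n] h) := by
    induction n with
    | zero => exact hh
    | succ k ih => rw [Function.iterate_succ']; exact (ih.stronglyMeasurable.integral_kernel (κ := κ)).measurable
  have hKb : ∀ y, |(kop κ)^[n] h y - m| ≤ 2 * Ch * (A * ρ ^ n) := henv h hh Ch hCh n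
  have hi1 : Integrable (fun y => h y * (kop κ)^[n] h y) π := by
    refine integrable_of_bounded π (hh.mul hKm) (C := Ch * (|m| + 2 * Ch * (A * ρ ^ n))) fun y => ?_
    rw [abs_mul]
    refine mul_le_mul (hCh y) ?_ (abs_nonneg _) hCh0
    calc |(kop κ)^[n] h y| = |m + ((kop κ)^[n] h y - m)| := by ring_nf
      _ ≤ |m| + |(kop κ)^[n] h y - m| := abs_add_le _ _
      _ ≤ |m| + 2 * Ch * (A * ρ ^ n) := by linarith [hKb y]
  have hi2 : Integrable (fun y => h y * m) π := (integrable_of_bounded π hh hCh).mul_const m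
  have e : ∫ y, h y * (kop κ)^[n] h y ∂π - m ^ 2 = ∫ y, h y * ((kop κ)^[n] h y - m) ∂π := by
    have : ∫ y, h y * ((kop κ)^[n] h y - m) ∂π = ∫ y, (h y * (kop κ)^[n] h y - h y * m) ∂π :=
      integral_congr_ae (ae_of_all _ fun y => by ring)
    rw [this, integral_sub hi1 hi2, integral_mul_const, ← hm]
    ring
  rw [e]
  have hid : Integrable (fun y => h y * ((kop κ)^[n] h y - m)) π := by
    have : (fun y => h y * ((kop κ)^[n] h y - m)) = fun y => h y * (kop κ)^[n] h y - h y * m := by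
      funext y; ring
    rw [this]; exact hi1.sub hi2
  calc |∫ y, h y * ((kop κ)^[n] h y - m) ∂π| ≤ ∫ y, |h y * ((kop κ)^[n] h y - m)| ∂π :=
        abs_integral_le_integral_abs
    _ ≤ ∫ y, Ch * (2 * Ch * (A * ρ ^ n)) ∂π := by
        refine integral_mono hid.abs (integrable_const _) fun y => ?_
        rw [abs_mul]
        exact mul_le_mul (hCh y) (hKb y) (abs_nonneg _) hCh0
    _ = 2 * Ch ^ 2 * A * ρ ^ n := by rw [integral_const, probReal_univ, one_smul]; ring

omit [IsMarkovKernel κ] in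
/-- `∫ h · (kop κ)^[n] h dπ → (∫ h dπ)²` as `n → ∞` under the envelope (`0 ≤ ρ < 1`). -/
theorem tendsto_integral_mul_iterate_kop_of_envelope
    (henv : ∀ (g : Ω → ℝ), Measurable g → ∀ (Cg : ℝ), (∀ x, |g x| ≤ Cg) →
      ∀ (t : ℕ) (x : Ω), |(kop κ)^[t] g x - ∫ y, g y ∂π| ≤ 2 * Cg * (A * ρ ^ t))
    (hρ0 : 0 ≤ ρ) (hρ1 : ρ < 1)
    {h : Ω → ℝ} (hh : Measurable h) {Ch : ℝ} (hCh : ∀ x, |h x| ≤ Ch) :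
    Tendsto (fun n : ℕ => ∫ y, h y * (kop κ)^[n] h y ∂π) atTop (𝓝 ((∫ y, h y ∂π) ^ 2)) := by
  have hgeo : Tendsto (fun n : ℕ => 2 * Ch ^ 2 * A * ρ ^ n) atTop (𝓝 0) := by
    simpa using (tendsto_pow_atTop_nhds_zero_of_lt_one hρ0 hρ1).const_mul (2 * Ch ^ 2 * A)
  have h0 : Tendsto (fun n : ℕ => ∫ y, h y * (kop κ)^[n] h y ∂π - (∫ y, h y ∂π) ^ 2) atTop (𝓝 0) :=
    squeeze_zero_norm (fun n => by
      simpa only [Real.norm_eq_abs] using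
        abs_integral_mul_iterate_kop_sub_sq_le_of_envelope (κ := κ) henv hh hCh n) hgeo
  have h1 := h0.add_const ((∫ y, h y ∂π) ^ 2)
  simp only [zero_add, sub_add_cancel] at h1
  exact h1

/-- **`σ²_f = 0 ⇒ E_π[S_{s,n}²] = 2 (∫ h² dπ − ∫ h (kop κ)^[n] h dπ)`** for every `s, n`: in the
degenerate case the stationary second moment of a centred block sum is that of the boundary term. -/
theorem chain_blockSum_sq_eq_of_greenKubo_eq_zero (hπ : Kernel.Invariant κ π)
    (henv : ∀ (g : Ω → ℝ), Measurable g → ∀ (Cg : ℝ), (∀ x, |g x| ≤ Cg) →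
      ∀ (t : ℕ) (x : Ω), |(kop κ)^[t] g x - ∫ y, g y ∂π| ≤ 2 * Cg * (A * ρ ^ t))
    (hρ0 : 0 ≤ ρ) (hρ1 : ρ < 1)
    {f : Ω → ℝ} (hf : Measurable f) {C : ℝ} (hC : ∀ x, |f x| ≤ C)
    {h : Ω → ℝ} (hh : Measurable h) {Ch : ℝ} (hCh : ∀ x, |h x| ≤ Ch)
    (hpois : ∀ y, h y - kop κ h y = f y - ∫ z, f z ∂π)
    (hσ : (∫ y, (f y - ∫ z, f z ∂π) ^ 2 ∂π)
        + 2 * ∑' k, ∫ y, (f y - ∫ z, f z ∂π) * (kop κ)^[k + 1] (fun y => f y - ∫ z, f z ∂π) y ∂π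
        = 0) (s n : ℕ) :
    ∫ x, (∑ t ∈ Finset.range n, (f (x (s + t)) - ∫ z, f z ∂π)) ^ 2
        ∂(Kernel.trajMeasure (X := fun _ : ℕ => Ω) π
          (fun n : ℕ => κ.comap (fun h : (i : ↥(Finset.Iic n)) → Ω => h ⟨n, Finset.mem_Iic.2 le_rfl⟩)
            (measurable_pi_apply _)))
      = 2 * (∫ y, h y ^ 2 ∂π - ∫ y, h y * (kop κ)^[n] h y ∂π) := by
  have hae := chain_blockSum_ae_eq_of_greenKubo_eq_zero hπ henv hρ0 hρ1 hf hC hh hCh hpois hσ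
  rw [integral_congr_ae (hae.mono fun x hx => show
      (∑ t ∈ Finset.range n, (f (x (s + t)) - ∫ z, f z ∂π)) ^ 2 = (h (x s) - h (x (s + n))) ^ 2 by
      rw [hx s n]), chain_sq_sub_eq_of_stationary hπ hh hCh s n]
  ring

/-- **`σ²_f = 0 ⇒ E_π[S_{s,n}²] → 2 Var_π(h) = 2 (∫ h² dπ − (∫ h dπ)²)`** as `n → ∞`, for every block
position `s`. -/
theorem tendsto_chain_blockSum_sq_of_greenKubo_eq_zero (hπ : Kernel.Invariant κ π)
    (henv : ∀ (g : Ω → ℝ), Measurable g → ∀ (Cg : ℝ), (∀ x, |g x| ≤ Cg) →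
      ∀ (t : ℕ) (x : Ω), |(kop κ)^[t] g x - ∫ y, g y ∂π| ≤ 2 * Cg * (A * ρ ^ t))
    (hρ0 : 0 ≤ ρ) (hρ1 : ρ < 1)
    {f : Ω → ℝ} (hf : Measurable f) {C : ℝ} (hC : ∀ x, |f x| ≤ C)
    {h : Ω → ℝ} (hh : Measurable h) {Ch : ℝ} (hCh : ∀ x, |h x| ≤ Ch)
    (hpois : ∀ y, h y - kop κ h y = f y - ∫ z, f z ∂π)
    (hσ : (∫ y, (f y - ∫ z, f z ∂π) ^ 2 ∂π)
        + 2 * ∑' k, ∫ y, (f y - ∫ z, f z ∂π) * (kop κ)^[k + 1] (fun y => f y - ∫ z, f z ∂π) y ∂π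
        = 0) (s : ℕ) :
    Tendsto (fun n : ℕ => ∫ x, (∑ t ∈ Finset.range n, (f (x (s + t)) - ∫ z, f z ∂π)) ^ 2
        ∂(Kernel.trajMeasure (X := fun _ : ℕ => Ω) π
          (fun n : ℕ => κ.comap (fun h : (i : ↥(Finset.Iic n)) → Ω => h ⟨n, Finset.mem_Iic.2 le_rfl⟩)
            (measurable_pi_apply _)))) atTop
      (𝓝 (2 * (∫ y, h y ^ 2 ∂π - (∫ y, h y ∂π) ^ 2))) := by
  have heq : (fun n : ℕ => ∫ x, (∑ t ∈ Finset.range n, (f (x (s + t)) - ∫ z, f z ∂π)) ^ 2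
        ∂(Kernel.trajMeasure (X := fun _ : ℕ => Ω) π
          (fun n : ℕ => κ.comap (fun h : (i : ↥(Finset.Iic n)) → Ω => h ⟨n, Finset.mem_Iic.2 le_rfl⟩)
            (measurable_pi_apply _))))
      = fun n : ℕ => 2 * (∫ y, h y ^ 2 ∂π - ∫ y, h y * (kop κ)^[n] h y ∂π) := by
    funext n
    exact chain_blockSum_sq_eq_of_greenKubo_eq_zero hπ henv hρ0 hρ1 hf hC hh hCh hpois hσ s n
  rw [heq]
  exact ((tendsto_integral_mul_iterate_kop_of_envelope (κ := κ) henv hρ0 hρ1 hh hCh).const_sub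
    _).const_mul 2

end Envelope

end Summit.Ventures.LatticeQCDFlow.Scoring

end
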